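import Literature.NumberTheory.EllipticCurves.IwasawaTwistModPTower
import Literature.NumberTheory.GaloisRepresentations.ContinuousCohomologyConnecting
import HarnessLib

/-!
# The `T`-adic tower of the mod-`(p, T^J)` twists, II: `ker (𝐇¹_Ω → H¹(K, M)) = T·𝐇¹_Ω` when `M^{Γ_K} = 0`
# (exactness of `0 → 𝒯_J →T 𝒯_{J+1} → M → 0` on `H¹`, passed to the limit; proofs, no fact)

Sequel of `IwasawaTwistModPTower` (cell `bsd-smallim`, crux `MuTransferX9` = item 19276, CORE-PLAN S0.6).
For `ρ : DiscreteGaloisModule K M` killed by `p`, `κ` a `ℤ_p`-extension and the twists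
`𝒯_J = M ⊗ 𝔽_p[T]/(T^J)(χ_κ)` (`κ.twistModP ρ hM J`):

* `isSES_shiftEmbed_constCoeff` — `0 → 𝒯_J →(T·) 𝒯_{J+1} →(mod T) M → 0` is a short exact sequence
  of discrete `Γ_K`-modules (tree `IsSES`; coordinates).
* `exists_shiftEmbedH1_eq_of_constCoeffH1_eq_zero` — exactness of `H¹(K, 𝒯_J) → H¹(K, 𝒯_{J+1}) →
  H¹(K, M)` at the middle (tree `IsSES.exists_map_one_eq_of_map_one_eq_zero`);
  `shiftEmbedH1_injective` — `H¹(K, 𝒯_J) → H¹(K, 𝒯_{J+1})` is injective when `M^{Γ_K} = 0` (tree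
  `IsSES.exists_δ₀_eq_of_map_one_eq_zero`: the kernel is `δ₀(H⁰(K, M)) = 0`).
* `exists_towerShift_eq_of_towerConst_eq_zero` — **in `𝐇¹_Ω = lim←_J H¹(K, 𝒯_J)`, a compatible family
  with zero reduction mod `T` is `T` times a (unique) compatible family**, provided `M^{Γ_K} = 0`.  With
  `towerConst_towerShift` (part I): `ker(𝐇¹_Ω → H¹(K, M)) = T·𝐇¹_Ω`, i.e. **`𝐇¹_Ω/T ↪ H¹(K, M)`** —
  MU-TRANSFER-PROOF (F4) "`κ̄' := κ' mod T ≠ 0` in `𝐇¹_Ω/T ↪ H¹(G_S, E[p])`" for `κ' ∉ T𝐇¹_Ω`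
  (`towerConst_ne_zero_of_not_mem_range`).  For `M = E[p]` with `E[p]` irreducible, `E(K)[p] = 0` supplies
  the hypothesis.

HONEST FRAMING: theorems only (one `IsSES` verification); nothing asserted; BSD is not advanced.

References: J.-P. Serre, *Galois Cohomology* I §2.2 (long exact sequence) [SerreGaloisCohomology1997];
B. Mazur, K. Rubin, Mem. AMS 799 (2004) §5.3 [MazurRubin2004]; HOME/koly/MU-TRANSFER-PROOF.md (F4).
-/

noncomputable section

open scoped ContRepresentation
open Field Filter CategoryTheory

universe u

namespace Literature.NumberTheory.EllipticCurves

open Literature.NumberTheory.GaloisRepresentations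

namespace ZpExtension

variable {K : Type u} [Field K] {p : ℕ} [Fact p.Prime] (κ : ZpExtension K p)
  {M : Type u} [AddCommGroup M] [TopologicalSpace M] [DiscreteTopology M]
  (ρ : DiscreteGaloisModule K M) (hM : ∀ x : M, p • x = 0) (J : ℕ)

/-! ## The short exact sequence `0 → 𝒯_J →T 𝒯_{J+1} → M → 0` -/

/-- `T· : 𝒯_J → 𝒯_{J+1}` (the `T`-embedding `twistModPShiftEmbed` for `J ≤ J+1`) as a morphism of
topological representations. [cite: Washington1997, §13.1–§13.2] -/
abbrev shiftEmbedHom : (κ.twistModP ρ hM J).toTopRep ⟶ (κ.twistModP ρ hM (J + 1)).toTopRep :=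
  TopRep.ofHom ⟨(κ.twistModPShiftEmbed ρ hM (J + 1) (Nat.le_succ J)).toContinuousLinearMap,
    (κ.twistModPShiftEmbed ρ hM (J + 1) (Nat.le_succ J)).isIntertwining'⟩

/-- `mod T : 𝒯_{J+1} → M` (the constant coefficient `twistModPConstCoeff`) as a morphism of topological
representations. [cite: Washington1997, §13.1–§13.2] -/
abbrev constCoeffHom : (κ.twistModP ρ hM (J + 1)).toTopRep ⟶ ρ.toTopRep :=
  TopRep.ofHom ⟨(κ.twistModPConstCoeff ρ hM (J + 1) (Nat.succ_pos J)).toContinuousLinearMap,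
    (κ.twistModPConstCoeff ρ hM (J + 1) (Nat.succ_pos J)).isIntertwining'⟩

omit [Fact p.Prime] [TopologicalSpace M] [DiscreteTopology M] in
/-- Coordinates of `T·x` in `𝒯_{J+1}`: `(T·x)_0 = 0` and `(T·x)_{i+1} = x_i`. [cite: Washington1997, §13.1–§13.2] -/
theorem shiftEmbed_succ_apply (x : Fin J → M) (i : Fin (J + 1)) :
    shiftEmbed (J + 1) (Nat.le_succ J) x i =
      if h : (i : ℕ) = 0 then 0 else x ⟨(i : ℕ) - 1, by omega⟩ := by
  rw [shiftEmbed_apply]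
  have hJ : J + 1 - J = 1 := by omega
  by_cases h : (i : ℕ) = 0
  · rw [dif_pos h, dif_neg (by omega)]
  · rw [dif_neg h, dif_pos (by omega)]
    congr 2
    omega

/-- **`0 → 𝒯_J →(T·) 𝒯_{J+1} →(mod T) M → 0` is a short exact sequence of discrete `Γ_K`-modules**
(`IsSES`): `T·` is injective with image the classes with zero constant coefficient, and `mod T` is onto
(`m ↦ (m, 0, …, 0)`). [cite: Washington1997, §13.1–§13.2] -/
theorem isSES_shiftEmbed_constCoeff :
    IsSES (κ.shiftEmbedHom ρ hM J) (κ.constCoeffHom ρ hM J) where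
  comp_eq_zero := by
    ext x
    change shiftEmbed (J + 1) (Nat.le_succ J) x ⟨0, Nat.succ_pos J⟩ = 0
    rw [shiftEmbed_succ_apply, dif_pos rfl]
  injective := by
    intro x y hxy
    funext i
    have := congrFun hxy i.succ
    change shiftEmbed (J + 1) (Nat.le_succ J) x i.succ = shiftEmbed (J + 1) (Nat.le_succ J) y i.succ
      at this
    rw [shiftEmbed_succ_apply, shiftEmbed_succ_apply, dif_neg (by simp), dif_neg (by simp)] at this
    simpa using this
  exact_mid := by
    intro y hy
    refine ⟨fun i => y i.succ, funext fun i => ?_⟩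
    change shiftEmbed (J + 1) (Nat.le_succ J) (fun i => y i.succ) i = y i
    rw [shiftEmbed_succ_apply]
    by_cases h : (i : ℕ) = 0
    · rw [dif_pos h]
      have hi : i = ⟨0, Nat.succ_pos J⟩ := Fin.ext h
      rw [hi]
      exact (hy : y ⟨0, Nat.succ_pos J⟩ = 0).symm
    · rw [dif_neg h]
      congr 1
      ext
      simp only [Fin.val_succ]
      omega
  surjective := by
    intro m
    refine ⟨fun i => if (i : ℕ) = 0 then m else 0, ?_⟩
    change (fun i : Fin (J + 1) => if (i : ℕ) = 0 then m else 0) ⟨0, Nat.succ_pos J⟩ = m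
    simp

/-! ## Exactness on `H¹` at one level -/

/-- `galoisCohomology.map` of an intertwining map is the tree's `cohomologyMap` of the attached morphism
(both are Mathlib's `ContinuousCohomology.map` along the identity; checked on classes).
[cite: SerreGaloisCohomology1997, I §2.2] -/
theorem galoisCohomology_map_eq_cohomologyMap {N : Type u} [AddCommGroup N] [TopologicalSpace N]
    [DiscreteTopology N] {ρ' : DiscreteGaloisModule K N}
    (f : (κ.twistModP ρ hM J).toContRepresentation →ⁱL ρ'.toContRepresentation)
    (c : galoisCohomology (κ.twistModP ρ hM J) 1) :
    galoisCohomology.map f 1 c =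
      cohomologyMap (TopRep.ofHom ⟨f.toContinuousLinearMap, f.isIntertwining'⟩ :
        (κ.twistModP ρ hM J).toTopRep ⟶ ρ'.toTopRep) 1 c := by
  obtain ⟨φ, rfl⟩ := oneCocycleClass_surjective _ c
  rw [map_oneCocycleClass_twist, cohomologyMap_oneCocycleClass]
  rfl

/-- **Exactness of `H¹(K, 𝒯_J) →T H¹(K, 𝒯_{J+1}) →(mod T) H¹(K, M)` at the middle**: a class of
`H¹(K, 𝒯_{J+1})` with zero constant coefficient is `T` times a class of `H¹(K, 𝒯_J)`.
[cite: SerreGaloisCohomology1997, I §2.2] -/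
theorem exists_shiftEmbedH1_eq_of_constCoeffH1_eq_zero (y : galoisCohomology (κ.twistModP ρ hM (J + 1)) 1)
    (hy : galoisCohomology.map (κ.twistModPConstCoeff ρ hM (J + 1) (Nat.succ_pos J)) 1 y = 0) :
    ∃ w : galoisCohomology (κ.twistModP ρ hM J) 1,
      galoisCohomology.map (κ.twistModPShiftEmbed ρ hM (J + 1) (Nat.le_succ J)) 1 w = y := by
  rw [galoisCohomology_map_eq_cohomologyMap] at hy
  obtain ⟨w, hw⟩ := (κ.isSES_shiftEmbed_constCoeff ρ hM J).exists_map_one_eq_of_map_one_eq_zero y hy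
  exact ⟨w, by rw [galoisCohomology_map_eq_cohomologyMap]; exact hw⟩

/-- **`T· : H¹(K, 𝒯_J) → H¹(K, 𝒯_{J+1})` is injective when `M^{Γ_K} = 0`**: its kernel is
`δ₀(H⁰(K, M)) = 0`. [cite: SerreGaloisCohomology1997, I §2.2] -/
theorem shiftEmbedH1_injective (hinv : ∀ m : M, (∀ σ : absoluteGaloisGroup K, ρ σ m = m) → m = 0) :
    Function.Injective (galoisCohomology.map (κ.twistModPShiftEmbed ρ hM (J + 1) (Nat.le_succ J)) 1) := by
  refine (injective_iff_map_eq_zero _).mpr fun w hw => ?_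
  rw [galoisCohomology_map_eq_cohomologyMap] at hw
  obtain ⟨v, hv⟩ := (κ.isSES_shiftEmbed_constCoeff ρ hM J).exists_δ₀_eq_of_map_one_eq_zero w hw
  have hv0 : v = 0 := Subtype.ext (hinv v.1 fun σ => v.2 σ)
  rw [← hv, hv0, map_zero]
  rfl

/-! ## Exactness in the limit: `ker(𝐇¹_Ω → H¹(K, M)) = T·𝐇¹_Ω` -/

variable {J} in
/-- The constant coefficient at level `J + 1` is the constant coefficient at level `1` after truncation
(on `H¹`). [cite: Washington1997, §13.1–§13.2] -/
theorem map_constCoeff_eq_map_constCoeff_truncH1 (c : galoisCohomology (κ.twistModP ρ hM (J + 1)) 1) :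
    galoisCohomology.map (κ.twistModPConstCoeff ρ hM (J + 1) (Nat.succ_pos J)) 1 c =
      galoisCohomology.map (κ.twistModPConstCoeff ρ hM 1 Nat.one_pos) 1
        (κ.truncH1 ρ hM (Nat.succ_le_succ (Nat.zero_le J)) c) := by
  obtain ⟨φ, rfl⟩ := oneCocycleClass_surjective _ c
  unfold truncH1
  rw [map_oneCocycleClass_twist, map_oneCocycleClass_twist, map_oneCocycleClass_twist]
  exact congrArg _ (Subtype.ext (ContinuousMap.ext fun σ => rfl))

variable {J} in
/-- `T·` commutes with truncation on `H¹`: `trunc_{J+1→J'+1} ∘ (T· on level J) = (T· on level J') ∘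
trunc_{J→J'}`. [cite: Washington1997, §13.1–§13.2] -/
theorem truncH1_map_shiftEmbed {J' : ℕ} (h : J' ≤ J) (w : galoisCohomology (κ.twistModP ρ hM J) 1) :
    κ.truncH1 ρ hM (Nat.succ_le_succ h)
        (galoisCohomology.map (κ.twistModPShiftEmbed ρ hM (J + 1) (Nat.le_succ J)) 1 w) =
      galoisCohomology.map (κ.twistModPShiftEmbed ρ hM (J' + 1) (Nat.le_succ J')) 1
        (κ.truncH1 ρ hM h w) := by
  unfold truncH1
  rw [κ.map_map_twist ρ hM J _ _
      ((κ.twistModPTruncate ρ hM (J + 1) (Nat.succ_le_succ h)).comp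
        (κ.twistModPShiftEmbed ρ hM (J + 1) (Nat.le_succ J))) (fun _ => rfl),
    κ.map_map_twist ρ hM J _ _
      ((κ.twistModPShiftEmbed ρ hM (J' + 1) (Nat.le_succ J')).comp (κ.twistModPTruncate ρ hM J h))
      (fun _ => rfl)]
  refine κ.map_eq_map_of_coe_eq ρ hM J _ _ (fun x => ?_) w
  change (fun i : Fin (J' + 1) => shiftEmbed (J + 1) (Nat.le_succ J) x (Fin.castLE (Nat.succ_le_succ h) i)) =
    shiftEmbed (J' + 1) (Nat.le_succ J') (fun i : Fin J' => x (Fin.castLE h i))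
  funext i
  rw [shiftEmbed_succ_apply, shiftEmbed_succ_apply]
  simp only [Fin.val_castLE]
  by_cases hi : (i : ℕ) = 0
  · rw [dif_pos hi, dif_pos hi]
  · rw [dif_neg hi, dif_neg hi]
    rfl

/-- `trunc_{J+1→J} ∘ (T· : H¹(𝒯_J) → H¹(𝒯_{J+1})) = T` (the shift within level `J`).
[cite: Washington1997, §13.1–§13.2] -/
theorem truncH1_map_shiftEmbed_eq_shiftH1 (w : galoisCohomology (κ.twistModP ρ hM J) 1) :
    κ.truncH1 ρ hM (Nat.le_succ J)
        (galoisCohomology.map (κ.twistModPShiftEmbed ρ hM (J + 1) (Nat.le_succ J)) 1 w) =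
      κ.shiftH1 ρ hM J w := by
  unfold truncH1 shiftH1
  rw [κ.map_map_twist ρ hM J _ _
      ((κ.twistModPTruncate ρ hM (J + 1) (Nat.le_succ J)).comp
        (κ.twistModPShiftEmbed ρ hM (J + 1) (Nat.le_succ J))) (fun _ => rfl)]
  refine κ.map_eq_map_of_coe_eq ρ hM J _ _ (fun x => ?_) w
  change (fun i : Fin J => shiftEmbed (J + 1) (Nat.le_succ J) x (Fin.castLE (Nat.le_succ J) i)) =
    shiftEnd M J x
  rw [castLE_shiftEmbed]
  have : J + 1 - J = 1 := by omega
  rw [this, pow_one]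

/-- **`ker(𝐇¹_Ω → H¹(K, M)) = T·𝐇¹_Ω` when `M^{Γ_K} = 0`**: a compatible family `x = (x_J)_J` whose
reduction mod `T` vanishes is `T·w` for a compatible family `w` — levelwise `x_{J+1} = T·w_J` by the
exactness of `H¹(K, 𝒯_J) →T H¹(K, 𝒯_{J+1}) → H¹(K, M)`, the `w_J` being unique (injectivity from
`M^{Γ_K} = 0`) hence compatible.  MU-TRANSFER-PROOF (F4): `𝐇¹_Ω/T ↪ H¹(G, E[p])`.
[cite: SerreGaloisCohomology1997, I §2.2] [cite: MazurRubin2004, §5.3] -/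
theorem exists_towerShift_eq_of_towerConst_eq_zero
    (hinv : ∀ m : M, (∀ σ : absoluteGaloisGroup K, ρ σ m = m) → m = 0)
    (x : κ.twistTower ρ hM) (hx : κ.towerConst ρ hM x = 0) :
    ∃ w : κ.twistTower ρ hM, κ.towerShift ρ hM w = x := by
  classical
  -- levelwise: `x_{J+1}` has zero constant coefficient
  have hx' : ∀ J, galoisCohomology.map (κ.twistModPConstCoeff ρ hM (J + 1) (Nat.succ_pos J)) 1
      (x.1 (J + 1)) = 0 := fun J => by
    rw [map_constCoeff_eq_map_constCoeff_truncH1, x.2 (J + 1) 1 (Nat.succ_le_succ (Nat.zero_le J))]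
    exact hx
  -- choose `w_J` with `T·w_J = x_{J+1}`
  choose w hw using fun J => κ.exists_shiftEmbedH1_eq_of_constCoeffH1_eq_zero ρ hM J (x.1 (J + 1)) (hx' J)
  -- compatibility by injectivity
  have hcompat : ∀ (J J' : ℕ) (h : J' ≤ J), κ.truncH1 ρ hM h (w J) = w J' := by
    intro J J' h
    apply κ.shiftEmbedH1_injective ρ hM J' hinv
    rw [← truncH1_map_shiftEmbed, hw J, hw J', x.2 (J + 1) (J' + 1) (Nat.succ_le_succ h)]
  refine ⟨⟨w, hcompat⟩, Subtype.ext (funext fun J => ?_)⟩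
  rw [towerShift_apply_coe]
  change κ.shiftH1 ρ hM J (w J) = x.1 J
  rw [← truncH1_map_shiftEmbed_eq_shiftH1, hw J, x.2 (J + 1) J (Nat.le_succ J)]

/-- **`κ' ∉ T·𝐇¹_Ω ⟹ κ' mod T ≠ 0` in `H¹(K, M)`** (when `M^{Γ_K} = 0`): the contrapositive of
`exists_towerShift_eq_of_towerConst_eq_zero` — MU-TRANSFER-PROOF (F4)/§5 STEP 1 input
"`h mod T = res κ̄' ≠ 0`". [cite: MazurRubin2004, §5.3] -/
theorem towerConst_ne_zero_of_not_mem_range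
    (hinv : ∀ m : M, (∀ σ : absoluteGaloisGroup K, ρ σ m = m) → m = 0)
    {y : κ.twistTower ρ hM} (hy : ∀ z : κ.twistTower ρ hM, κ.towerShift ρ hM z ≠ y) :
    κ.towerConst ρ hM y ≠ 0 := fun h => by
  obtain ⟨w, hw⟩ := κ.exists_towerShift_eq_of_towerConst_eq_zero ρ hM hinv y h
  exact hy w hw

end ZpExtension

end Literature.NumberTheory.EllipticCurves

end
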